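import Summits.Ventures.PercRepro.GenQFlatLatticeR

/-!
# PercRepro — the flat-lattice counting rows: (G-C) at `q = 7` in the certificate vocabulary (night-4, gen 24)

`gc_row_seven`: the `q = 7` twin of part R's `gc_row_six` — the `k`-subsets of `G` are of rank `7` (the level `n − k`) or
of rank `≤ 6`, and the latter have a spanning complement (`gA`) or a non-spanning one, which lies in a hyperplane
(rank `6`, spanning trace `h_s`) or in a lower flat (a line / plane / solid / rank-`5` flat), at most
`C(s, k + s − n)` of them per flat with an `s`-point trace (`card_nonspanning_compl_le_sharp`).  This is the row (G-C)
of the trace layer of the `(10, 8)` profile LP at `q = 7` (the cases `(7, 23, 0)`, `(7, 25, 0)` are LP-positive only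
through it — night-4 g23's census).  Imports `GenQFlatLatticeR`.
-/
namespace PercRepro.Night4

open Finset ThmH SixFour GenQ PerFlat Star

variable {α : Type*} [DecidableEq α] {M : Matroid α} [M.Finite]

/-- **(G-C) at `q = 7` in the certificate vocabulary** (`k ≤ n − 7`, simple `M`):
`C(n, k) ≤ Σ_m #Pc (n−k) m + gA_k + Σ_{s ≥ n−k} C(s, k + s − n)·(h_s + Nl s + NR 3 s + N4 s + NR 5 s)`. -/
theorem gc_row_seven (hs : Simple M) {G : Finset α} (hG : G ⊆ gr M)
    (hrG : M.eRk (G : Set α) = ((7 : ℕ) : ℕ∞)) {k : ℕ} (hkn : k + 7 ≤ G.card) :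
    G.card.choose k ≤ ∑ m ∈ Finset.Icc (mTr M G) 7, (Pc M G 7 (G.card - k) m).card + gA M G 7 7 k
      + ∑ s ∈ Finset.Icc (G.card - k) G.card,
          s.choose (k + s - G.card) * (hypTr M G 6 s + Nl M G s + NR M G 3 s + N4 M G s + NR M G 5 s) := by
  classical
  -- `C(n, k) = #{rank ≤ 6} + #{rank 7}`
  have hsplit := Finset.card_filter_add_card_filter_not
    (s := G.powersetCard k) (p := fun A : Finset α => M.eRk (A : Set α) + 1 ≤ ((7 : ℕ) : ℕ∞))
  rw [Finset.card_powersetCard, card_rank_ge_self_eq hrG, card_rank_q_subsets_eq_sum_Pc hG hrG (by omega)]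
    at hsplit
  -- `#{rank ≤ 6} ≤ gA + #{non-spanning complement}`
  have hgA : ((G.powersetCard k).filter (fun A : Finset α => M.eRk (A : Set α) + 1 ≤ ((7 : ℕ) : ℕ∞))).card
      ≤ gA M G 7 7 k + ((G.powersetCard k).filter (fun A : Finset α => G \ A ∉ Rq M G 7)).card := by
    unfold gA
    rw [← Finset.card_union_of_disjoint]
    · refine Finset.card_le_card (fun A hA => ?_)
      rw [Finset.mem_filter] at hA
      rw [Finset.mem_union, Finset.mem_filter, Finset.mem_filter]
      by_cases hR : G \ A ∈ Rq M G 7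
      · exact Or.inl ⟨hA.1, hA.2, hR⟩
      · exact Or.inr ⟨hA.1, hR⟩
    · rw [Finset.disjoint_left]
      intro A hA hA'
      rw [Finset.mem_filter] at hA hA'
      exact hA'.2 hA.2.2
  have hcov := card_nonspanning_compl_le_sharp (q := 7) hG hrG k
  -- the ranks `0 … 6` of the cover, as the LP's atoms
  have hranks : ∑ ρ ∈ Finset.range 7, ∑ s ∈ Finset.Icc (G.card - k) G.card,
        s.choose (k + s - G.card) * hypTr M G ρ s
      ≤ ∑ s ∈ Finset.Icc (G.card - k) G.card,
          s.choose (k + s - G.card) * (hypTr M G 6 s + Nl M G s + NR M G 3 s + N4 M G s + NR M G 5 s) := by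
    simp only [Finset.sum_range_succ, Finset.sum_range_zero, zero_add]
    have hz : ∀ ρ, ρ ≤ 1 → ∑ s ∈ Finset.Icc (G.card - k) G.card, s.choose (k + s - G.card) * hypTr M G ρ s = 0 := by
      intro ρ hρ
      refine Finset.sum_eq_zero (fun s hs' => ?_)
      rw [Finset.mem_Icc] at hs'
      rw [hypTr_eq_zero_of_le_one hs G hρ (by omega), mul_zero]
    rw [hz 0 (by norm_num), hz 1 (by norm_num), zero_add, zero_add]
    rw [← Finset.sum_add_distrib, ← Finset.sum_add_distrib, ← Finset.sum_add_distrib, ← Finset.sum_add_distrib]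
    refine Finset.sum_le_sum (fun s _ => ?_)
    have e2 := (hypTr_le_NR (M := M) G 2 s).trans (le_of_eq (NR_two_eq_Nl G s))
    have e3 := hypTr_le_NR (M := M) G 3 s
    have e4 := (hypTr_le_NR (M := M) G 4 s).trans (le_of_eq (NR_four G s))
    have e5 := hypTr_le_NR (M := M) G 5 s
    nlinarith [Nat.zero_le (s.choose (k + s - G.card)), Nat.mul_le_mul_left (s.choose (k + s - G.card)) e2,
      Nat.mul_le_mul_left (s.choose (k + s - G.card)) e3, Nat.mul_le_mul_left (s.choose (k + s - G.card)) e4,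
      Nat.mul_le_mul_left (s.choose (k + s - G.card)) e5]
  omega

end PercRepro.Night4
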